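import Summits.AtomisticToContinuum.Crystallization.Theorems.ChargedEnergyGapWeightLedger
import HarnessLib

/-!
# `ChargedEnergyGap` — the pieces, the glue and ★★ the record cone over an ARBITRARY core weight system; the weights of record as an instance
# (cell `decomp-a2c`, lens 3, generation 52, node «WeightLedger», part O-B; over part O-A `…Theorems.ChargedEnergyGapWeightLedger`)

Over an abstract core weight system `W : CoreWeights θ ε R r η L δ L' ϱ` (part O-A: axioms W1–W8 only) this part states the
weight-dependent leaves of the record cone — REG-BALL_W|σ (`CoreBallRegularPricingW`), LABEL_W (`CleanLabellingW`), CB-FAR_W|cored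
(`FarLabelledFloorCoredW`) — and the two internal nodes CLEAN-FAR_W (`FarCleanFloorW`), CB-FAR_W (`FarLabelledFloorW`); proves the split
CLEAN-FAR_W ⟸ LABEL_W ∧ CB-FAR_W, the EQUIV ★ CB-FAR_W ⟺ CB-FAR_W|cored (`0 ≤ ρ₀`, by the core-free floor of part O-A), ★★ the glue
REG-BALL_W ∧ CLEAN-FAR_W ⟹ NGP_G (`κ = κ₀ − c₁`, `C = (C₀ + C₁ + sepFloor s)(2ρ₀/s + 1)³`; one-sided guard splits, conservation of
credits, packing) and ★★ THE RECORD CONE FOR EVERY WEIGHT SYSTEM AT EVERY SCALE: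
  `ChargeRecount · IP_G · FCP_G · CCP_G · REG-BALL_W · LABEL_W · CB-FAR_W|cored · P_G ⟹ ChargedEnergyGap`
at `(θ, ε, R, r, η, L, δ, L', c₁, s, ρ₀, lam, ℓ) = (3/20, 1/10, 6/5, 10, 1/100, 40, 1/10, 40, 1/20, 3/5, 10, 1/3, 3)`, any `ϱ`, any `W`.
§4 instantiates `W` at the WEIGHTS OF RECORD (part I-A; `recordWeights`): the three leaves of record of parts L-D / M-A / N-A are
recovered DEFINITIONALLY (`Iff.rfl`), and the record cone of part N-A is re-derived as the generic cone at `recordWeights` — the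
certificate that re-basing the ledger on another weight system (max cover, part O-C; soft-max; …) is MECHANICAL: it is an instance.

§1 Pieces and dials.  §2 Split, WEAKER certificates, EQUIV cored ⟺ uncored.  §3 ★★ Glue to NGP_G and the record cone ∀ `W`.
§4 The weights of record as a `CoreWeights`; definitional agreement with the tree; the tree's cone as an instance.

TAGS.  REG-BALL_W|σ: UNDECIDED · INSTRUMENTABLE · IDEA-NEEDED (as REG-BALL_G).  LABEL_W: TRUE-type · ATTACKABLE-M.  CB-FAR_W|cored:
depends on `W` — FALSE-LEANING for the weights of record (sum cover; transfer audit g51 §2, census C10), TRUE-leaning for the max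
cover (part O-C; census C11).  Everything else here is PROVED. -/

noncomputable section
open scoped Classical
open Literature.MathematicalPhysics.StatisticalMechanics
open Literature.Geometry.DiscreteGeometry
open Summit.AtomisticToContinuum.Crystallization.Theses.PricedLinkCensus
open Summit.AtomisticToContinuum.Crystallization.Theorems.ChargedEnergyGapNegative

namespace Summit.AtomisticToContinuum.Crystallization.Theorems.ChargedEnergyGapChartDial

/-! ## §1 The pieces over `W` -/

section Pieces

variable {θ ε R r η L δ L' ϱ : ℝ} (W : CoreWeights θ ε R r η L δ L' ϱ) (c₁ s ρ₀ lam ℓ : ℝ)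

/-- piece REG-BALL_W|σ · UNDECIDED · INSTRUMENTABLE · IDEA-NEEDED.  **GUARDED CORE BALL PRICING ON THE REGULAR ACCOUNT** over the weight
system `W`: in every guarded configuration the regular ball account of every incoherent core `x` with `σ x` pays some `κ₀ > c₁` per
weighted core inside, up to `C₀` per weighted point within `ρ₀` of an other gross charged site.  Why it might fail: as REG-BALL_G (an
unimprovable deep-rigid incoherent core whose `ϱ`-ball relaxes its misfit elastically below `c₁` per core — census C5d/C6). -/
def CoreBallRegularPricingW (σ : ∀ Q : PeriodicConfiguration 3, Q.motif → Prop) : Prop :=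
  ∃ κ₀ C₀ : ℝ, c₁ < κ₀ ∧ 0 ≤ C₀ ∧ ∀ Q : PeriodicConfiguration 3, Guard ε s Q → ∀ x : Q.motif, IsCore θ ε R r η L δ L' Q x →
    σ Q x → κ₀ * ballCoreCountW W Q x - C₀ * ballNearDebitW W ρ₀ Q x ≤ ballRegularExcessW W Q x

/-- node CLEAN-FAR_W (⟸ LABEL_W ∧ CB-FAR_W, `farCleanFloorW_of_labelling_of_labelledFloor`).  **GUARDED FAR FLOOR ON THE CLEAN ACCOUNT**
over `W`: `−C₁ · farNearDebitW − c₁ · #cores ≤ farCleanExcessW` in every guarded configuration. -/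
def FarCleanFloorW : Prop :=
  ∃ C₁ : ℝ, 0 ≤ C₁ ∧ ∀ Q : PeriodicConfiguration 3, Guard ε s Q →
    -(C₁ * farNearDebitW W ρ₀ Q) - c₁ * (motifCoreIncoherent θ ε R r η L δ L' Q : ℝ) ≤ farCleanExcessW W ρ₀ Q

/-- piece LABEL_W · TRUE-type · ATTACKABLE-M · INSTRUMENTABLE.  **CLEAN LABELLING** over `W`: every motif site of a guarded configuration
that is not other-gross, not near-gross and of positive far weight `W.far` is Barlow-labelled within `ℓ` at strain `lam`.  Why it
might fail: only if `θ`-charted shells admit a plain cluster with no single stacking reference at radius `(1 + lam)·ℓ` and no gross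
site within `ρ₀` (as LABEL_G; the selector `0 < W.far` only places the site beyond `ϱ/2` from every core, W6). -/
def CleanLabellingW : Prop :=
  ∀ Q : PeriodicConfiguration 3, Guard ε s Q → ∀ y : Q.motif, ¬ IsOtherGross θ ε R r η L δ L' Q y →
    ¬ NearOtherGross θ ε R r η L δ L' ρ₀ Q y → 0 < W.far Q (y : E3) → LabelledWithin lam ℓ Q (y : E3)

/-- node CB-FAR_W (WEAKER than CLEAN-FAR_W; ⟺ CB-FAR_W|cored).  **FAR FLOOR GIVEN THE LABELLINGS** over `W`. -/
def FarLabelledFloorW : Prop :=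
  ∃ C₁ : ℝ, 0 ≤ C₁ ∧ ∀ Q : PeriodicConfiguration 3, Guard ε s Q →
    (∀ y : Q.motif, ¬ IsOtherGross θ ε R r η L δ L' Q y → ¬ NearOtherGross θ ε R r η L δ L' ρ₀ Q y →
        0 < W.far Q (y : E3) → LabelledWithin lam ℓ Q (y : E3)) →
      -(C₁ * farNearDebitW W ρ₀ Q) - c₁ * (motifCoreIncoherent θ ε R r η L δ L' Q : ℝ) ≤ farCleanExcessW W ρ₀ Q

/-- piece CB-FAR_W|cored ⟺ CB-FAR_W (`farLabelledFloorW_iff_cored`) · truth DEPENDS ON `W` (false-leaning for the sum cover of record,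
true-leaning for the max cover) · ATTACKABLE-L · INSTRUMENTABLE (census C10/C11).  **FAR FLOOR GIVEN THE LABELLINGS, CORED
CONFIGURATIONS ONLY** over `W`.  Why it might fail: a shell-normal displacement supported in the transition shell `{0 < W.far < 1}`
lowers `Σ far·(E_y − e*)` at first order through the `∇³`-moment of `W.far` while the balls absorb it — fatal when the shell is thin
(sum cover: width `≈ 9` along a line core, harmonic optimum `≈ 0.9` per unit length vs slack `≈ 0.2–0.4`). -/
def FarLabelledFloorCoredW : Prop :=
  ∃ C₁ : ℝ, 0 ≤ C₁ ∧ ∀ Q : PeriodicConfiguration 3, Guard ε s Q → 0 < motifCoreIncoherent θ ε R r η L δ L' Q →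
    (∀ y : Q.motif, ¬ IsOtherGross θ ε R r η L δ L' Q y → ¬ NearOtherGross θ ε R r η L δ L' ρ₀ Q y →
        0 < W.far Q (y : E3) → LabelledWithin lam ℓ Q (y : E3)) →
      -(C₁ * farNearDebitW W ρ₀ Q) - c₁ * (motifCoreIncoherent θ ε R r η L δ L' Q : ℝ) ≤ farCleanExcessW W ρ₀ Q

variable {c₁ s ρ₀ lam ℓ}

/-- Restriction is monotone in the sub-species. -/
theorem CoreBallRegularPricingW.mono {σ τ : ∀ Q : PeriodicConfiguration 3, Q.motif → Prop} (hστ : ∀ Q x, τ Q x → σ Q x)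
    (h : CoreBallRegularPricingW W c₁ s ρ₀ σ) : CoreBallRegularPricingW W c₁ s ρ₀ τ := by
  obtain ⟨κ₀, C₀, hκ, hC, hball⟩ := h
  exact ⟨κ₀, C₀, hκ, hC, fun Q hQ x hx hτ => hball Q hQ x hx (hστ Q x hτ)⟩

/-- REG-BALL_W is antitone in the slack `c₁` … -/
theorem CoreBallRegularPricingW.anti {c₁' : ℝ} (hc : c₁' ≤ c₁) {σ : ∀ Q : PeriodicConfiguration 3, Q.motif → Prop}
    (h : CoreBallRegularPricingW W c₁ s ρ₀ σ) : CoreBallRegularPricingW W c₁' s ρ₀ σ := by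
  obtain ⟨κ₀, C₀, hκ, hC, hball⟩ := h
  exact ⟨κ₀, C₀, hc.trans_lt hκ, hC, hball⟩

/-- … and CB-FAR_W|cored is monotone in it. -/
theorem FarLabelledFloorCoredW.mono {c₁' : ℝ} (hc : c₁ ≤ c₁') (h : FarLabelledFloorCoredW W c₁ s ρ₀ lam ℓ) :
    FarLabelledFloorCoredW W c₁' s ρ₀ lam ℓ := by
  obtain ⟨C₁, hC, h⟩ := h
  refine ⟨C₁, hC, fun Q hQ hpos hlab => ?_⟩
  have h1 := h Q hQ hpos hlab
  have h2 : c₁ * (motifCoreIncoherent θ ε R r η L δ L' Q : ℝ) ≤ c₁' * (motifCoreIncoherent θ ε R r η L δ L' Q : ℝ) :=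
    mul_le_mul_of_nonneg_right hc (Nat.cast_nonneg _)
  linarith

/-- LABEL_W is monotone in the strain budget `lam` … -/
theorem CleanLabellingW.mono {lam' : ℝ} (hlam : lam ≤ lam') (h : CleanLabellingW W s ρ₀ lam ℓ) : CleanLabellingW W s ρ₀ lam' ℓ :=
  fun Q hQ y hg hn hw => (h Q hQ y hg hn hw).mono hlam

/-- … and CB-FAR_W|cored antitone in it. -/
theorem FarLabelledFloorCoredW.anti_lam {lam' : ℝ} (hlam : lam' ≤ lam) (h : FarLabelledFloorCoredW W c₁ s ρ₀ lam ℓ) :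
    FarLabelledFloorCoredW W c₁ s ρ₀ lam' ℓ := by
  obtain ⟨C₁, hC, h⟩ := h
  exact ⟨C₁, hC, fun Q hQ hpos hlab => h Q hQ hpos fun y hg hn hw => (hlab y hg hn hw).mono hlam⟩

/-- ★ **EXACT ∀-SPLIT** of REG-BALL_W along any cut `σ` of the cores. -/
theorem coreBallRegularPricingW_iff_on_and_on_not (σ : ∀ Q : PeriodicConfiguration 3, Q.motif → Prop) :
    CoreBallRegularPricingW W c₁ s ρ₀ (fun _ _ => True) ↔
      CoreBallRegularPricingW W c₁ s ρ₀ σ ∧ CoreBallRegularPricingW W c₁ s ρ₀ fun Q x => ¬ σ Q x := by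
  constructor
  · intro h
    exact ⟨h.mono W fun _ _ _ => trivial, h.mono W fun _ _ _ => trivial⟩
  · rintro ⟨⟨κ₁, C₁, hκ₁, hC₁, h₁⟩, ⟨κ₂, C₂, hκ₂, hC₂, h₂⟩⟩
    refine ⟨min κ₁ κ₂, max C₁ C₂, lt_min hκ₁ hκ₂, le_max_of_le_left hC₁, fun Q hQ x hx _ => ?_⟩
    have hcc := ballCoreCountW_nonneg W Q x
    have hoc := ballNearDebitW_nonneg W (ρ₀ := ρ₀) Q x
    by_cases hσ : σ Q x
    · have := h₁ Q hQ x hx hσ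
      nlinarith [min_le_left κ₁ κ₂, le_max_left C₁ C₂]
    · have := h₂ Q hQ x hx hσ
      nlinarith [min_le_right κ₁ κ₂, le_max_right C₁ C₂]

end Pieces

/-! ## §2 The split, the WEAKER certificates, and ★ the EQUIV cored ⟺ uncored -/

section Split

variable {θ ε R r η L δ L' ϱ : ℝ} (W : CoreWeights θ ε R r η L δ L' ϱ) {c₁ s ρ₀ lam ℓ : ℝ}

/-- ★ **THE SPLIT** (glue, proved): LABEL_W ∧ CB-FAR_W ⟹ CLEAN-FAR_W. -/
theorem farCleanFloorW_of_labelling_of_labelledFloor (hL : CleanLabellingW W s ρ₀ lam ℓ) (hF : FarLabelledFloorW W c₁ s ρ₀ lam ℓ) :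
    FarCleanFloorW W c₁ s ρ₀ := by
  obtain ⟨C₁, hC, h⟩ := hF
  exact ⟨C₁, hC, fun Q hQ => h Q hQ (hL Q hQ)⟩

/-- CB-FAR_W is WEAKER than CLEAN-FAR_W (drop the labelling hypothesis). -/
theorem farLabelledFloorW_of_clean (h : FarCleanFloorW W c₁ s ρ₀) : FarLabelledFloorW W c₁ s ρ₀ lam ℓ := by
  obtain ⟨C₁, hC, h⟩ := h
  exact ⟨C₁, hC, fun Q hQ _ => h Q hQ⟩

/-- CB-FAR_W ⟹ CB-FAR_W|cored (restriction; same coefficient). -/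
theorem farLabelledFloorCoredW_of_labelledFloor (h : FarLabelledFloorW W c₁ s ρ₀ lam ℓ) : FarLabelledFloorCoredW W c₁ s ρ₀ lam ℓ := by
  obtain ⟨C₁, hC, h⟩ := h
  exact ⟨C₁, hC, fun Q hQ _ hlab => h Q hQ hlab⟩

/-- ★ CB-FAR_W|cored ⟹ CB-FAR_W (`0 ≤ ρ₀`; coefficient `max C₁ (max 0 ((ε − e*)/2))`): core-free configurations are floored by
`farCleanExcessW_coreFree_ge`. -/
theorem farLabelledFloorW_of_cored (hρ : 0 ≤ ρ₀) (h : FarLabelledFloorCoredW W c₁ s ρ₀ lam ℓ) : FarLabelledFloorW W c₁ s ρ₀ lam ℓ := by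
  obtain ⟨C₁, hC, h⟩ := h
  refine ⟨max C₁ (max 0 ((ε - eStar) / 2)), hC.trans (le_max_left _ _), fun Q hQ hlab => ?_⟩
  have hd : 0 ≤ farNearDebitW W ρ₀ Q := farNearDebitW_nonneg W Q
  by_cases h0 : motifCoreIncoherent θ ε R r η L δ L' Q = 0
  · have hcf := farCleanExcessW_coreFree_ge W (ρ₀ := ρ₀) hQ hρ (not_isCore_of_motifCoreIncoherent_eq_zero h0)
    have h1 : max 0 ((ε - eStar) / 2) * farNearDebitW W ρ₀ Q ≤ max C₁ (max 0 ((ε - eStar) / 2)) * farNearDebitW W ρ₀ Q :=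
      mul_le_mul_of_nonneg_right (le_max_right _ _) hd
    rw [h0, Nat.cast_zero, mul_zero, sub_zero]
    linarith
  · have h1 := h Q hQ (Nat.pos_of_ne_zero h0) hlab
    have h2 : C₁ * farNearDebitW W ρ₀ Q ≤ max C₁ (max 0 ((ε - eStar) / 2)) * farNearDebitW W ρ₀ Q :=
      mul_le_mul_of_nonneg_right (le_max_left _ _) hd
    linarith

/-- ★★ **CB-FAR_W ⟺ CB-FAR_W|cored** (`0 ≤ ρ₀`). -/
theorem farLabelledFloorW_iff_cored (hρ : 0 ≤ ρ₀) : FarLabelledFloorW W c₁ s ρ₀ lam ℓ ↔ FarLabelledFloorCoredW W c₁ s ρ₀ lam ℓ :=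
  ⟨farLabelledFloorCoredW_of_labelledFloor W, farLabelledFloorW_of_cored W hρ⟩

/-- The core-free rung: CLEAN-FAR_W (hence CB-FAR_W, CB-FAR_W|cored) holds outright at any `δ ≥ 5/8` (no incoherent cores, part H-A). -/
theorem farCleanFloorW_of_five_eighths_le (hδ : 5 / 8 ≤ δ) (hρ : 0 ≤ ρ₀) : FarCleanFloorW W c₁ s ρ₀ := by
  refine ⟨max 0 ((ε - eStar) / 2), le_max_left _ _, fun Q hQ => ?_⟩
  have hno : ∀ x : Q.motif, ¬ IsCore θ ε R r η L δ L' Q x := fun x hx =>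
    hx.not_coherentWithin (coherentWithin_of_five_eighths_le hδ L' Q _)
  exact farCleanFloorW_of_not_isCore W c₁ hQ hρ hno

end Split

/-! ## §3 ★★ The glue to the guarded engine target and the record cone for every weight system -/

section Glue

variable {θ ε R r η L δ L' ϱ : ℝ} (W : CoreWeights θ ε R r η L δ L' ϱ) {c₁ s ρ₀ : ℝ}

/-- ★★ **THE GLUE** (every parameter, scale, slack; guard `0 < s`, radius `0 ≤ ρ₀`; axioms W1–W5, W7, W8 only):
`REG-BALL_W ∧ CLEAN-FAR_W ⟹ NGP_G` with `κ = κ₀ − c₁ > 0` and `C = (C₀ + C₁ + sepFloor s)(2ρ₀/s + 1)³`. -/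
theorem incoherentGrossDebitPricingG_of_regularBallW_cleanFarW (hs : 0 < s) (hρ : 0 ≤ ρ₀)
    (hB : CoreBallRegularPricingW W c₁ s ρ₀ fun _ _ => True) (hF : FarCleanFloorW W c₁ s ρ₀) :
    IncoherentGrossDebitPricingG θ ε R r η L δ L' s := by
  obtain ⟨κ₀, C₀, hκ, hC₀, hball⟩ := hB
  obtain ⟨C₁, hC₁, hfar⟩ := hF
  have hP : (0 : ℝ) ≤ (2 * ρ₀ / s + 1) ^ 3 := by positivity
  have hsf : 0 ≤ sepFloor s := sepFloor_nonneg hs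
  refine ⟨κ₀ - c₁, (C₀ + C₁ + sepFloor s) * (2 * ρ₀ / s + 1) ^ 3, sub_pos.2 hκ, by positivity, fun Q hQ => ?_⟩
  have hL := excess_eq_sum_ballExcessW_add_farExcessW W Q
  have hballs : (∑ x : Q.motif, (κ₀ * ballCoreCountW W Q x - (C₀ + sepFloor s) * ballNearDebitW W ρ₀ Q x)) ≤
      ∑ x : Q.motif, ballExcessW W Q x := by
    refine Finset.sum_le_sum fun x _ => ?_
    have hsplit := ballRegularExcessW_sub_le_ballExcessW W hQ hs hρ x
    have hnd := ballNearDebitW_nonneg W (ρ₀ := ρ₀) Q x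
    by_cases hx : IsCore θ ε R r η L δ L' Q x
    · have h1 := hball Q hQ x hx trivial
      rw [add_mul]
      linarith
    · rw [ballExcessW_of_not_isCore W hx, ballCoreCountW_of_not_isCore W hx, mul_zero, zero_sub, neg_nonpos]
      exact mul_nonneg (add_nonneg hC₀ hsf) hnd
  rw [Finset.sum_sub_distrib, ← Finset.mul_sum, ← Finset.mul_sum, sum_ballCoreCountW_eq] at hballs
  have hF' := hfar Q hQ
  have hfs := farCleanExcessW_sub_le_farExcessW W hQ hs hρ
  have hpack := sum_ballNearDebitW_add_farNearDebitW_le W hQ hs hρ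
  have hfn := farNearDebitW_nonneg W (ρ₀ := ρ₀) Q
  have hbn : 0 ≤ ∑ x : Q.motif, ballNearDebitW W ρ₀ Q x := Finset.sum_nonneg fun x _ => ballNearDebitW_nonneg W Q x
  rw [cast_motifChargedGross_sub_incoherent θ ε R r η L δ L' Q]
  set O := (Nat.card {x : Q.motif // IsOtherGross θ ε R r η L δ L' Q x} : ℝ)
  set B := ∑ x : Q.motif, ballNearDebitW W ρ₀ Q x
  set Fd := farNearDebitW W ρ₀ Q
  have h1 : (C₀ + sepFloor s) * B ≤ (C₀ + C₁ + sepFloor s) * B := mul_le_mul_of_nonneg_right (by linarith) hbn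
  have h2 : (C₁ + sepFloor s) * Fd ≤ (C₀ + C₁ + sepFloor s) * Fd := mul_le_mul_of_nonneg_right (by linarith) hfn
  have h3 : (C₀ + C₁ + sepFloor s) * (B + Fd) ≤ (C₀ + C₁ + sepFloor s) * ((2 * ρ₀ / s + 1) ^ 3 * O) :=
    mul_le_mul_of_nonneg_left hpack (by linarith)
  have h4 : (C₀ + C₁ + sepFloor s) * ((2 * ρ₀ / s + 1) ^ 3 * O) = (C₀ + C₁ + sepFloor s) * (2 * ρ₀ / s + 1) ^ 3 * O := by ring
  have h5 : (C₀ + C₁ + sepFloor s) * (B + Fd) = (C₀ + C₁ + sepFloor s) * B + (C₀ + C₁ + sepFloor s) * Fd := by ring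
  have h6 : (C₁ + sepFloor s) * Fd = C₁ * Fd + sepFloor s * Fd := by ring
  linarith

/-- ★★ **THE RECORD CONE FOR EVERY WEIGHT SYSTEM AT EVERY SCALE**, eight named leaves: `ChargeRecount · IP_G · FCP_G · CCP_G ·
REG-BALL_W · LABEL_W · CB-FAR_W|cored · P_G ⟹ ChargedEnergyGap` at `(θ, ε, R, r, η, L, δ, L', c₁, s, ρ₀, lam, ℓ) = (3/20, 1/10, 6/5,
10, 1/100, 40, 1/10, 40, 1/20, 3/5, 10, 1/3, 3)`, any `ϱ`, any `W : CoreWeights … ϱ`. -/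
theorem chargedEnergyGap_of_weightLedger {ϱ : ℝ} (W : CoreWeights (3 / 20) (1 / 10) (6 / 5) 10 (1 / 100) 40 (1 / 10) 40 ϱ)
    (hF : ChargeRecount)
    (hIP : ImprovablePricingG (3 / 20) (1 / 10) (6 / 5) 10 (1 / 100) (3 / 5))
    (hFCP : FrustratedCorePricingG (3 / 20) (1 / 10) (6 / 5) 10 (1 / 100) 40 (3 / 5))
    (hCCP : CoherentCorePricingG (3 / 20) (1 / 10) (6 / 5) 10 (1 / 100) 40 (1 / 10) 40 (3 / 5))
    (hB : CoreBallRegularPricingW W (1 / 20) (3 / 5) 10 fun _ _ => True)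
    (hLab : CleanLabellingW W (3 / 5) 10 (1 / 3) 3)
    (hCB : FarLabelledFloorCoredW W (1 / 20) (3 / 5) 10 (1 / 3) 3)
    (hP : ChartedChargePricingG (3 / 20) (1 / 10) (3 / 5)) : ChargedEnergyGap :=
  chargedEnergyGap_of_guardedChain hF le_rfl hIP hFCP hCCP
    (incoherentGrossDebitPricingG_of_regularBallW_cleanFarW W (by norm_num) (by norm_num) hB
      (farCleanFloorW_of_labelling_of_labelledFloor W hLab (farLabelledFloorW_of_cored W (by norm_num) hCB))) hP

end Glue

/-! ## §4 The weights of record (part I-A) as a core weight system; definitional agreement with the tree -/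

section Record

variable (θ ε R r η L δ L' ϱ : ℝ)

/-- The **WEIGHTS OF RECORD** (part I-A: `ballWeight`, `farWeight` — the sum cover) as a core weight system: W1–W8 are the invariants
proved in parts I-A (`ballWeight_nonneg`, `farWeight_nonneg`, `ballWeight_sum_add_farWeight`, `ballWeight_of_not_isCore`,
`farWeight_eq_zero_of_isCore`), M-A (`lt_orbitDist_of_farWeight_pos`) and L-C (`ballWeight_add_period`, `farWeight_add_period`). -/
def recordWeights : CoreWeights θ ε R r η L δ L' ϱ where
  ball Q x q := ballWeight θ ε R r η L δ L' ϱ Q x q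
  far Q q := farWeight θ ε R r η L δ L' ϱ Q q
  ball_nonneg Q x q := ballWeight_nonneg Q x q
  far_nonneg Q q := farWeight_nonneg Q q
  sum_ball_add_far Q q := ballWeight_sum_add_farWeight Q q
  ball_of_not_isCore _ _ hx q := ballWeight_of_not_isCore hx q
  far_of_isCore _ _ hy := farWeight_eq_zero_of_isCore hy
  lt_orbitDist_of_far_pos hϱ _ _ hw _ hx := lt_orbitDist_of_farWeight_pos θ ε R r η L δ L' ϱ hϱ hw hx
  ball_add_period Q x _ hg q := ballWeight_add_period Q x hg q
  far_add_period Q _ hg q := farWeight_add_period Q hg q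

variable {θ ε R r η L δ L' ϱ} {c₁ s ρ₀ lam ℓ : ℝ}

/-- The accounts of record are the generic accounts at `recordWeights` (definitionally). -/
theorem ballExcessW_record (Q : PeriodicConfiguration 3) (x : Q.motif) :
    ballExcessW (recordWeights θ ε R r η L δ L' ϱ) Q x = ballExcess θ ε R r η L δ L' ϱ Q x := rfl

/-- (far account) -/
theorem farExcessW_record (Q : PeriodicConfiguration 3) : farExcessW (recordWeights θ ε R r η L δ L' ϱ) Q = farExcess θ ε R r η L δ L' ϱ Q := rfl

/-- (regular ball account) -/
theorem ballRegularExcessW_record (Q : PeriodicConfiguration 3) (x : Q.motif) :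
    ballRegularExcessW (recordWeights θ ε R r η L δ L' ϱ) Q x = ballRegularExcess θ ε R r η L δ L' ϱ Q x := rfl

/-- (clean far account) -/
theorem farCleanExcessW_record (Q : PeriodicConfiguration 3) :
    farCleanExcessW (recordWeights θ ε R r η L δ L' ϱ) ρ₀ Q = farCleanExcess θ ε R r η L δ L' ϱ ρ₀ Q := rfl

/-- (credit count) -/
theorem ballCoreCountW_record (Q : PeriodicConfiguration 3) (x : Q.motif) :
    ballCoreCountW (recordWeights θ ε R r η L δ L' ϱ) Q x = ballCoreCount θ ε R r η L δ L' ϱ Q x := rfl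

/-- (neighbourhood debits) -/
theorem ballNearDebitW_record (Q : PeriodicConfiguration 3) (x : Q.motif) :
    ballNearDebitW (recordWeights θ ε R r η L δ L' ϱ) ρ₀ Q x = ballNearDebit θ ε R r η L δ L' ϱ ρ₀ Q x := rfl

/-- (far neighbourhood debit) -/
theorem farNearDebitW_record (Q : PeriodicConfiguration 3) :
    farNearDebitW (recordWeights θ ε R r η L δ L' ϱ) ρ₀ Q = farNearDebit θ ε R r η L δ L' ϱ ρ₀ Q := rfl

/-- ★ REG-BALL_W|σ at the weights of record IS REG-BALL_G|σ of part L-D (definitionally). -/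
theorem coreBallRegularPricingW_record_iff (σ : ∀ Q : PeriodicConfiguration 3, Q.motif → Prop) :
    CoreBallRegularPricingW (recordWeights θ ε R r η L δ L' ϱ) c₁ s ρ₀ σ ↔ CoreBallRegularPricingG θ ε R r η L δ L' ϱ c₁ s ρ₀ σ :=
  Iff.rfl

/-- ★ LABEL_W at the weights of record IS LABEL_G of part M-A. -/
theorem cleanLabellingW_record_iff :
    CleanLabellingW (recordWeights θ ε R r η L δ L' ϱ) s ρ₀ lam ℓ ↔ CleanLabellingG θ ε R r η L δ L' ϱ s ρ₀ lam ℓ :=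
  Iff.rfl

/-- ★ CB-FAR_W|cored at the weights of record IS CB-FAR_G|cored of part N-A. -/
theorem farLabelledFloorCoredW_record_iff :
    FarLabelledFloorCoredW (recordWeights θ ε R r η L δ L' ϱ) c₁ s ρ₀ lam ℓ ↔
      FarLabelledFloorCoredG θ ε R r η L δ L' ϱ c₁ s ρ₀ lam ℓ :=
  Iff.rfl

/-- (CB-FAR_W and CLEAN-FAR_W likewise.) -/
theorem farLabelledFloorW_record_iff :
    FarLabelledFloorW (recordWeights θ ε R r η L δ L' ϱ) c₁ s ρ₀ lam ℓ ↔ FarLabelledFloorG θ ε R r η L δ L' ϱ c₁ s ρ₀ lam ℓ :=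
  Iff.rfl

/-- (clean floor) -/
theorem farCleanFloorW_record_iff :
    FarCleanFloorW (recordWeights θ ε R r η L δ L' ϱ) c₁ s ρ₀ ↔ FarCleanFloorG θ ε R r η L δ L' ϱ c₁ s ρ₀ :=
  Iff.rfl

/-- ★★ **THE RECORD CONE OF PART N-A IS AN INSTANCE**: `chargedEnergyGap_of_coredLedger_record` re-derived as the generic cone at the
weights of record (the certificate that re-basing the ledger on another weight system is mechanical). -/
theorem chargedEnergyGap_of_coredLedger_record' (hF : ChargeRecount)
    (hIP : ImprovablePricingG (3 / 20) (1 / 10) (6 / 5) 10 (1 / 100) (3 / 5))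
    (hFCP : FrustratedCorePricingG (3 / 20) (1 / 10) (6 / 5) 10 (1 / 100) 40 (3 / 5))
    (hCCP : CoherentCorePricingG (3 / 20) (1 / 10) (6 / 5) 10 (1 / 100) 40 (1 / 10) 40 (3 / 5))
    (hB : CoreBallRegularPricingG (3 / 20) (1 / 10) (6 / 5) 10 (1 / 100) 40 (1 / 10) 40 160 (1 / 20) (3 / 5) 10 fun _ _ => True)
    (hLab : CleanLabellingG (3 / 20) (1 / 10) (6 / 5) 10 (1 / 100) 40 (1 / 10) 40 160 (3 / 5) 10 (1 / 3) 3)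
    (hCB : FarLabelledFloorCoredG (3 / 20) (1 / 10) (6 / 5) 10 (1 / 100) 40 (1 / 10) 40 160 (1 / 20) (3 / 5) 10 (1 / 3) 3)
    (hP : ChartedChargePricingG (3 / 20) (1 / 10) (3 / 5)) : ChargedEnergyGap :=
  chargedEnergyGap_of_weightLedger (recordWeights (3 / 20) (1 / 10) (6 / 5) 10 (1 / 100) 40 (1 / 10) 40 160) hF hIP hFCP hCCP
    ((coreBallRegularPricingW_record_iff _).2 hB) (cleanLabellingW_record_iff.2 hLab) (farLabelledFloorCoredW_record_iff.2 hCB) hP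

end Record

end Summit.AtomisticToContinuum.Crystallization.Theorems.ChargedEnergyGapChartDial

end
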